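import Literature.AnabelianGeometry.SemiGraphs.SgAToProfinite
import HarnessLib

/-!
# [SemiAnbd] §2/§3: 1-morphisms of semi-graphs of anabelioids read on the profinite presentations (bridge B2)

Mochizuki, *Semi-graphs of anabelioids*, Publ. RIMS **42** (2006), Def. 2.1 p. 22 / Rmk 2.4.2 p. 26
(a 1-morphism `φ : 𝒢 → ℋ`: a morphism of underlying semi-graphs, 1-morphisms of anabelioids
`φ_v : 𝒢_v → ℋ_{f v}`, `φ_e : 𝒢_e → ℋ_{f e}` and 2-cells `φ_b` along the branches), §2 p. 23
("`Π_v`, `Π_b` … for some choice of basepoint … well-defined up to conjugation") and Def. 5.1 (iv)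
p. 63 ("a continuous homomorphism of profinite groups and a morphism of semi-graphs … compatible …
up to composition with the inner action") (kurims `paper:url-f33ace170ff4`).
[cite: MochizukiSemiAnbd2006, Rem. 2.4.2 p.26]

Step B2 of the (R1) bridge of the §§4–5 container (HOME/staging/L3/L3-t3/MERGE-MAP.md §4 (1);
interface owner abc-iut-L3-t3), over B1 `SgAToProfinite.lean` (`𝒢.toProfinite`): a 1-morphism
`φ : HomOver 𝒢 ℋ f` of abc-iut-L3-t1's categorical presentation induces a morphism
`φ.toProfinite : ProfiniteSemiGraph.Hom 𝒢.toProfinite ℋ.toProfinite` of abc-iut-L3-t2's profinite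
presentations:

* `HomOver.vertexPath` / `edgePath` — CHOSEN paths from the basepoints induced by `φ_v`, `φ_e`
  (fibre functors by `fiberFunctor_comp_of_exact`) to the canonical basepoints of `ℋ`;
* `HomOver.hVOfPath` / `hEOfPath` (any path), `hVProfinite` / `hEAt` (the chosen ones) —
  `π₁(φ_v^*)`, `π₁(φ_e^*)` (`pi1Map`, continuous) followed by transport; changing the path
  conjugates (`hVOfPath_eq_conj`, `hEOfPath_eq_conj`);
* `HomOver.exists_conj_hVOfPath_brHomOfPath` — THE SQUARE ALONG A BRANCH COMMUTES UP TO CONJUGATION: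
  the 2-cell `φ_b` read on fundamental groups, through the general transport lemma
  `exists_conj_autMulEquivOfIso_pi1Map_of_iso` (isomorphic pull-back functors have conjugate `π₁`'s
  after transport to a common basepoint; `pi1Map_of_iso`, `pi1Map_conjAut`, `pi1Map_comp`);
* `HomOver.toProfinite`, `Hom.toProfinite` — the morphism of profinite presentations (its `comm` is
  the previous item at the chosen paths);
* `exists_conj_hVProfinite_of_iso2` / `exists_conj_hEAt_of_iso2` — 2-ISOMORPHIC 1-morphisms induce
  CONJUGATE homomorphisms (so the construction descends to the arrows of `SgAQuot` up to inner
  automorphisms, as Def. 5.1 (iv) reads morphisms);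
* `isLocallyOpen_toProfinite_iff` — t2's `ProfiniteSemiGraph.Hom.IsLocallyOpen` (open images at the
  canonical basepoints) ↔ t1's `Hom.IsLocallyOpen` (open images at EVERY basepoint), by basepoint
  independence `isOpen_range_pi1Map_iff_of_iso`.

Sequel steps (not here): B3 `𝒢.toProfinite.toAnab ≅ 𝒢`; B4 tempered arrows of `SgA` through
`CovObj.coveringGraph` of `𝒢.toProfinite` (Def. 3.5 (ii)).  Definitions + bookkeeping lemmas only;
nothing of the paper is asserted; no side taken on [IUTchIII] Cor. 3.12.
-/

noncomputable section

namespace Literature.AnabelianGeometry.SemiGraphs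

open CategoryTheory CategoryTheory.Limits CategoryTheory.PreGaloisCategory
open Literature.AnabelianGeometry.Anabelioids
open SemiGraphOfAnabelioids (transportAut)

universe u

/-! ### Transport bookkeeping: two readings of `π₁` of isomorphic functors are conjugate -/

section TransportLemmas

variable {D : Type*} [Category D]

/-- Two paths `p, p₂ : A ≅ G` transport an automorphism of `A` to CONJUGATE automorphisms of `G`
(conjugation by `p⁻¹ ≫ p₂ = transportAut p p₂`). [cite: MochizukiGeoAn2004, Def. 1.1.2(ii) p.10] -/
theorem Aut.autMulEquivOfIso_eq_conj_of_paths {A G : D} (p p₂ : A ≅ G) (y : Aut A) :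
    Aut.autMulEquivOfIso p₂ y =
      transportAut p p₂ * Aut.autMulEquivOfIso p y * (transportAut p p₂)⁻¹ := by
  ext : 1
  simp [Aut.autMulEquivOfIso, transportAut, Aut.Aut_mul_def, Aut.Aut_inv_def]

variable {X : Type u} [Category.{u} X] {Y : Type u} [Category.{u} Y] {W : Type u} [Category.{u} W]

/-- `π₁` read through a composite and two transports: for `B : Y ⥤ X` with a path `α : B ⋙ F ≅ G'`
and `P : W ⥤ Y` with a path `γ : P ⋙ G' ≅ G`,
`γ ⋆ π₁(P) (α ⋆ π₁(B) x) = (P ◁ α ≫ γ) ⋆ π₁(P ⋙ B) x` (`pi1Map_conjAut`, `pi1Map_comp`).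
[cite: MochizukiGeoAn2004, Def. 1.1.2(ii) p.10] -/
theorem Aut.autMulEquivOfIso_pi1Map_autMulEquivOfIso_pi1Map (B : Y ⥤ X) (F : X ⥤ FintypeCat.{u})
    {G' : Y ⥤ FintypeCat.{u}} (α : B ⋙ F ≅ G') (P : W ⥤ Y) {G : W ⥤ FintypeCat.{u}}
    (γ : P ⋙ G' ≅ G) (x : Aut F) :
    Aut.autMulEquivOfIso γ (pi1Map P G' (Aut.autMulEquivOfIso α (pi1Map B F x))) =
      Aut.autMulEquivOfIso (X := (P ⋙ B) ⋙ F) (Functor.isoWhiskerLeft P α ≪≫ γ)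
        (pi1Map (P ⋙ B) F x) := by
  rw [Aut.autMulEquivOfIso_apply_eq_conjAut, Aut.autMulEquivOfIso_apply_eq_conjAut,
    Aut.autMulEquivOfIso_apply_eq_conjAut, pi1Map_conjAut, Iso.trans_conjAut]
  rfl

/-- **Isomorphic pull-back functors have conjugate `π₁`'s after transport to a common basepoint**:
for `i : Q ≅ Q'` and paths `p : Q ⋙ F ≅ G`, `p' : Q' ⋙ F ≅ G` there is `g ∈ Aut G` with
`p' ⋆ π₁(Q') σ = g (p ⋆ π₁(Q) σ) g⁻¹` for all `σ` ([GeoAn] §1.1: induced morphisms of fundamental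
groups are well defined up to inner automorphism). [cite: MochizukiGeoAn2004, Def. 1.1.2(ii) p.10] -/
theorem exists_conj_autMulEquivOfIso_pi1Map_of_iso {Q Q' : Y ⥤ X} (i : Q ≅ Q')
    (F : X ⥤ FintypeCat.{u}) {G : Y ⥤ FintypeCat.{u}} (p : Q ⋙ F ≅ G) (p' : Q' ⋙ F ≅ G) :
    ∃ g : Aut G, ∀ σ : Aut F,
      Aut.autMulEquivOfIso p' (pi1Map Q' F σ) = g * Aut.autMulEquivOfIso p (pi1Map Q F σ) * g⁻¹ := by
  refine ⟨transportAut p (Functor.isoWhiskerRight i F ≪≫ p'), fun σ => ?_⟩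
  rw [pi1Map_of_iso i F σ, ← Aut.autMulEquivOfIso_apply_eq_conjAut,
    ← Aut.autMulEquivOfIso_eq_conj_of_paths p (Functor.isoWhiskerRight i F ≪≫ p'),
    Aut.autMulEquivOfIso_apply_eq_conjAut, Aut.autMulEquivOfIso_apply_eq_conjAut,
    Aut.autMulEquivOfIso_apply_eq_conjAut, Iso.trans_conjAut]

/-- Transport along `α` is a homeomorphism: it preserves and reflects openness of subsets.
[cite: MochizukiGeoAn2004, Def. 1.1.2(ii) p.10] -/
theorem Aut.isOpen_image_autMulEquivOfIso_iff {C : Type*} [Category.{u} C] {F G : C ⥤ FintypeCat.{u}}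
    (α : F ≅ G) (S : Set (Aut F)) : IsOpen (Aut.autMulEquivOfIso α '' S) ↔ IsOpen S :=
  (Aut.continuousMulEquivOfIso α).toHomeomorph.isOpen_image

/-- The image of `π₁(P)` at the basepoint `F'` is the transport, along `P ◁ e`, of its image at the
basepoint `F` (`pi1Map_conjAut`). [cite: MochizukiGeoAn2004, Def. 1.1.2(ii) p.10] -/
theorem range_pi1Map_eq_image_of_iso (P : Y ⥤ X) {F F' : X ⥤ FintypeCat.{u}} (e : F ≅ F') :
    Set.range (pi1Map P F') =
      Aut.autMulEquivOfIso (Functor.isoWhiskerLeft P e) '' Set.range (pi1Map P F) := by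
  ext τ
  constructor
  · rintro ⟨σ', rfl⟩
    refine ⟨pi1Map P F (e.symm.conjAut σ'), ⟨_, rfl⟩, ?_⟩
    have hσ : e.conjAut (e.symm.conjAut σ') = σ' := by
      ext : 1
      rw [Iso.conjAut_hom, Iso.conjAut_hom, Iso.self_symm_conj]
    rw [Aut.autMulEquivOfIso_apply_eq_conjAut, ← pi1Map_conjAut, hσ]
  · rintro ⟨_, ⟨σ, rfl⟩, rfl⟩
    exact ⟨e.conjAut σ, by rw [pi1Map_conjAut, Aut.autMulEquivOfIso_apply_eq_conjAut]⟩

/-- **Open image of `π₁(P)` is independent of the basepoint**: open at one fibre functor iff open at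
any other (the images are transports of each other along a homeomorphism).
[cite: MochizukiGeoAn2004, Def. 1.1.2(ii) p.10] -/
theorem isOpen_range_pi1Map_iff_of_iso (P : Y ⥤ X) {F F' : X ⥤ FintypeCat.{u}} (e : F ≅ F') :
    IsOpen (Set.range (pi1Map P F')) ↔ IsOpen (Set.range (pi1Map P F)) := by
  rw [range_pi1Map_eq_image_of_iso P e, Aut.isOpen_image_autMulEquivOfIso_iff]

end TransportLemmas

namespace SemiGraphOfAnabelioids

variable {𝒢 ℋ : SemiGraphOfAnabelioids.{u, u, u}} {f : 𝒢.graph ⟶ ℋ.graph} (φ : HomOver 𝒢 ℋ f)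

namespace HomOver

/-! ### Paths from the basepoints induced by the components of a 1-morphism -/

/-- The basepoint of `ℋ_{f v}` induced by the vertex component `φ_v : 𝒢_v → ℋ_{f v}` from the
canonical basepoint of `𝒢_v` is a basepoint ([SGA1] V 6.1). [cite: MochizukiSemiAnbd2006, Rem. 2.4.2 p.26] -/
theorem fiberFunctor_φV_comp_fibV (v : 𝒢.graph.Vertex) :
    FiberFunctor ((φ.φV v).pullback ⋙ 𝒢.fibV v) :=
  fiberFunctor_comp_of_exact _ _

/-- A path from the basepoint induced by `φ_v` to the canonical basepoint of `ℋ_{f v}` exists.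
[cite: MochizukiSemiAnbd2006, Rem. 2.4.2 p.26] -/
theorem nonempty_vertexPath (v : 𝒢.graph.Vertex) :
    Nonempty ((φ.φV v).pullback ⋙ 𝒢.fibV v ≅ ℋ.fibV (f.vertexMap v)) := by
  haveI := φ.fiberFunctor_φV_comp_fibV v
  exact nonempty_iso_of_fiberFunctor _ _

/-- A CHOSEN path `γ_v : φ_v^* ⋙ F_{𝒢,v} ≅ F_{ℋ,f v}`. [cite: MochizukiSemiAnbd2006, Rem. 2.4.2 p.26] -/
noncomputable def vertexPath (v : 𝒢.graph.Vertex) :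
    (φ.φV v).pullback ⋙ 𝒢.fibV v ≅ ℋ.fibV (f.vertexMap v) :=
  Classical.choice (φ.nonempty_vertexPath v)

/-- The basepoint of `ℋ_{e'}` induced by the edge component `φ_e : 𝒢_e → ℋ_{e'}` is a basepoint.
[cite: MochizukiSemiAnbd2006, Rem. 2.4.2 p.26] -/
theorem fiberFunctor_φE_comp_fibE (e : 𝒢.graph.Edge) (e' : ℋ.graph.Edge) (h : f.edgeMap e = e') :
    FiberFunctor ((φ.φE e e' h).pullback ⋙ 𝒢.fibE e) :=
  fiberFunctor_comp_of_exact _ _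

/-- A path from the basepoint induced by `φ_e` to the canonical basepoint of `ℋ_{e'}` exists.
[cite: MochizukiSemiAnbd2006, Rem. 2.4.2 p.26] -/
theorem nonempty_edgePath (e : 𝒢.graph.Edge) (e' : ℋ.graph.Edge) (h : f.edgeMap e = e') :
    Nonempty ((φ.φE e e' h).pullback ⋙ 𝒢.fibE e ≅ ℋ.fibE e') := by
  haveI := φ.fiberFunctor_φE_comp_fibE e e' h
  exact nonempty_iso_of_fiberFunctor _ _

/-- A CHOSEN path `γ_e : φ_e^* ⋙ F_{𝒢,e} ≅ F_{ℋ,e'}`. [cite: MochizukiSemiAnbd2006, Rem. 2.4.2 p.26] -/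
noncomputable def edgePath (e : 𝒢.graph.Edge) (e' : ℋ.graph.Edge) (h : f.edgeMap e = e') :
    (φ.φE e e' h).pullback ⋙ 𝒢.fibE e ≅ ℋ.fibE e' :=
  Classical.choice (φ.nonempty_edgePath e e' h)

/-! ### The continuous homomorphisms on `Π_v`, `Π_e` -/

/-- `π₁(φ_v) : Π_{𝒢,v} → Π_{ℋ,f v}` at the canonical basepoints, for a path `γ`: `π₁(φ_v^*)`
(`pi1Map`, continuous) followed by transport along `γ` ("a continuous homomorphism of profinite
groups … up to inner automorphism", [SemiAnbd] §2 p.23 / Def 5.1 (iv)).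
[cite: MochizukiSemiAnbd2006, Rem. 2.4.2 p.26] -/
noncomputable def hVOfPath (v : 𝒢.graph.Vertex)
    (γ : (φ.φV v).pullback ⋙ 𝒢.fibV v ≅ ℋ.fibV (f.vertexMap v)) :
    Aut (𝒢.fibV v) →ₜ* Aut (ℋ.fibV (f.vertexMap v)) :=
  (Aut.continuousMulEquivOfIso γ : _ →ₜ* _).comp
    { toMonoidHom := pi1Map (φ.φV v).pullback (𝒢.fibV v)
      continuous_toFun := continuous_pi1Map _ _ }

/-- Pointwise formula. [cite: MochizukiSemiAnbd2006, Rem. 2.4.2 p.26] -/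
@[simp] theorem hVOfPath_apply (v : 𝒢.graph.Vertex)
    (γ : (φ.φV v).pullback ⋙ 𝒢.fibV v ≅ ℋ.fibV (f.vertexMap v)) (x : Aut (𝒢.fibV v)) :
    φ.hVOfPath v γ x = Aut.autMulEquivOfIso γ (pi1Map (φ.φV v).pullback (𝒢.fibV v) x) :=
  rfl

/-- `π₁(φ_e) : Π_{𝒢,e} → Π_{ℋ,e'}` at the canonical basepoints, for a path `γ`.
[cite: MochizukiSemiAnbd2006, Rem. 2.4.2 p.26] -/
noncomputable def hEOfPath (e : 𝒢.graph.Edge) (e' : ℋ.graph.Edge) (h : f.edgeMap e = e')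
    (γ : (φ.φE e e' h).pullback ⋙ 𝒢.fibE e ≅ ℋ.fibE e') :
    Aut (𝒢.fibE e) →ₜ* Aut (ℋ.fibE e') :=
  (Aut.continuousMulEquivOfIso γ : _ →ₜ* _).comp
    { toMonoidHom := pi1Map (φ.φE e e' h).pullback (𝒢.fibE e)
      continuous_toFun := continuous_pi1Map _ _ }

/-- Pointwise formula. [cite: MochizukiSemiAnbd2006, Rem. 2.4.2 p.26] -/
@[simp] theorem hEOfPath_apply (e : 𝒢.graph.Edge) (e' : ℋ.graph.Edge) (h : f.edgeMap e = e')
    (γ : (φ.φE e e' h).pullback ⋙ 𝒢.fibE e ≅ ℋ.fibE e') (x : Aut (𝒢.fibE e)) :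
    φ.hEOfPath e e' h γ x = Aut.autMulEquivOfIso γ (pi1Map (φ.φE e e' h).pullback (𝒢.fibE e) x) :=
  rfl

/-- The vertex homomorphism along the CHOSEN path. [cite: MochizukiSemiAnbd2006, Rem. 2.4.2 p.26] -/
noncomputable def hVProfinite (v : 𝒢.graph.Vertex) :
    Aut (𝒢.fibV v) →ₜ* Aut (ℋ.fibV (f.vertexMap v)) :=
  φ.hVOfPath v (φ.vertexPath v)

/-- The edge homomorphism (indexed as the edge components are, by `(e, e', h)`) along the CHOSEN
path. [cite: MochizukiSemiAnbd2006, Rem. 2.4.2 p.26] -/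
noncomputable def hEAt (e : 𝒢.graph.Edge) (e' : ℋ.graph.Edge) (h : f.edgeMap e = e') :
    Aut (𝒢.fibE e) →ₜ* Aut (ℋ.fibE e') :=
  φ.hEOfPath e e' h (φ.edgePath e e' h)

/-- Re-indexing the edge homomorphism along an equality of target edges is transport.
[cite: MochizukiSemiAnbd2006, Rem. 2.4.2 p.26] -/
theorem hEAt_cast (e : 𝒢.graph.Edge) {e' : ℋ.graph.Edge} (h : e' = f.edgeMap e)
    (x : Aut (𝒢.fibE e)) :
    h ▸ φ.hEAt e (f.edgeMap e) rfl x = φ.hEAt e e' h.symm x := by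
  subst h
  rfl

/-- Changing the vertex path conjugates `π₁(φ_v)`. [cite: MochizukiSemiAnbd2006, Rem. 2.4.2 p.26] -/
theorem hVOfPath_eq_conj (v : 𝒢.graph.Vertex)
    (γ γ' : (φ.φV v).pullback ⋙ 𝒢.fibV v ≅ ℋ.fibV (f.vertexMap v)) (x : Aut (𝒢.fibV v)) :
    φ.hVOfPath v γ' x = transportAut γ γ' * φ.hVOfPath v γ x * (transportAut γ γ')⁻¹ := by
  rw [hVOfPath_apply, hVOfPath_apply]
  exact Aut.autMulEquivOfIso_eq_conj_of_paths γ γ' _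

/-- Changing the edge path conjugates `π₁(φ_e)`. [cite: MochizukiSemiAnbd2006, Rem. 2.4.2 p.26] -/
theorem hEOfPath_eq_conj (e : 𝒢.graph.Edge) (e' : ℋ.graph.Edge) (h : f.edgeMap e = e')
    (γ γ' : (φ.φE e e' h).pullback ⋙ 𝒢.fibE e ≅ ℋ.fibE e') (x : Aut (𝒢.fibE e)) :
    φ.hEOfPath e e' h γ' x = transportAut γ γ' * φ.hEOfPath e e' h γ x * (transportAut γ γ')⁻¹ := by
  rw [hEOfPath_apply, hEOfPath_apply]
  exact Aut.autMulEquivOfIso_eq_conj_of_paths γ γ' _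

/-! ### Compatibility with the branch homomorphisms, up to conjugation -/

/-- **The square along a branch commutes up to conjugation**: for the branch `b` of `e` abutting
to `v`, `π₁(φ_v) ∘ b_* ` and `(f b)_* ∘ π₁(φ_e)` (at the canonical basepoints, along ANY paths)
differ by an inner automorphism of `Π_{ℋ, f v}` — the 2-cell `φ_b` of the 1-morphism read on
fundamental groups. [cite: MochizukiSemiAnbd2006, Rem. 2.4.2 p.26] -/
theorem exists_conj_hVOfPath_brHomOfPath (b : 𝒢.graph.Branch) (v : 𝒢.graph.Vertex)
    (h : 𝒢.graph.abuts b = some v)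
    (α𝒢 : (𝒢.pull b v h).pullback ⋙ 𝒢.fibE (𝒢.graph.edgeOf b) ≅ 𝒢.fibV v)
    (γv : (φ.φV v).pullback ⋙ 𝒢.fibV v ≅ ℋ.fibV (f.vertexMap v))
    (γe : (φ.φE (𝒢.graph.edgeOf b) (ℋ.graph.edgeOf (f.branchMap b))
        (f.edgeOf_branchMap b).symm).pullback ⋙ 𝒢.fibE (𝒢.graph.edgeOf b) ≅
        ℋ.fibE (ℋ.graph.edgeOf (f.branchMap b)))
    (αℋ : (ℋ.pull (f.branchMap b) (f.vertexMap v) (f.abuts_branchMap b v h)).pullback ⋙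
        ℋ.fibE (ℋ.graph.edgeOf (f.branchMap b)) ≅ ℋ.fibV (f.vertexMap v)) :
    ∃ g : Aut (ℋ.fibV (f.vertexMap v)), ∀ x : Aut (𝒢.fibE (𝒢.graph.edgeOf b)),
      φ.hVOfPath v γv (𝒢.brHomOfPath b v h α𝒢 x) =
        g * ℋ.brHomOfPath (f.branchMap b) (f.vertexMap v) (f.abuts_branchMap b v h) αℋ
          (φ.hEOfPath (𝒢.graph.edgeOf b) (ℋ.graph.edgeOf (f.branchMap b))
            (f.edgeOf_branchMap b).symm γe x) * g⁻¹ := by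
  obtain ⟨g, hg⟩ := exists_conj_autMulEquivOfIso_pi1Map_of_iso (φ.φB b v h)
    (𝒢.fibE (𝒢.graph.edgeOf b))
    (Functor.isoWhiskerLeft (φ.φV v).pullback α𝒢 ≪≫ γv)
    (Functor.isoWhiskerLeft
      (ℋ.pull (f.branchMap b) (f.vertexMap v) (f.abuts_branchMap b v h)).pullback γe ≪≫ αℋ)
  refine ⟨g⁻¹, fun x => ?_⟩
  rw [hVOfPath_apply, brHomOfPath_apply, brHomOfPath_apply, hEOfPath_apply,
    Aut.autMulEquivOfIso_pi1Map_autMulEquivOfIso_pi1Map,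
    Aut.autMulEquivOfIso_pi1Map_autMulEquivOfIso_pi1Map, hg x, inv_inv]
  group

/-! ### The morphism of profinite presentations -/

/-- **A 1-morphism of semi-graphs of anabelioids induces a morphism of profinite presentations**
(Def. 2.1 / Rmk 2.4.2 read on fundamental groups, as in §3 and Def. 5.1 (iv): "a continuous
homomorphism … and a morphism of semi-graphs … compatible … up to composition with the inner
action"): base `f`, `π₁(φ_v)`, `π₁(φ_e)` at the canonical basepoints along the chosen paths, the
squares along branches commuting up to conjugation by `exists_conj_hVOfPath_brHomOfPath`.
[cite: MochizukiSemiAnbd2006, Rem. 2.4.2 p.26] -/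
noncomputable def toProfinite : ProfiniteSemiGraph.Hom 𝒢.toProfinite ℋ.toProfinite where
  base := f
  hV v := φ.hVProfinite v
  hE e := φ.hEAt e (f.edgeMap e) rfl
  comm b v h := by
    obtain ⟨g, hg⟩ := φ.exists_conj_hVOfPath_brHomOfPath b v h (𝒢.branchPath b v h)
      (φ.vertexPath v)
      (φ.edgePath (𝒢.graph.edgeOf b) (ℋ.graph.edgeOf (f.branchMap b)) (f.edgeOf_branchMap b).symm)
      (ℋ.branchPath (f.branchMap b) (f.vertexMap v) (f.abuts_branchMap b v h))
    refine ⟨g, fun x => ?_⟩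
    have hc := φ.hEAt_cast (𝒢.graph.edgeOf b) (f.edgeOf_branchMap b) x
    change φ.hVProfinite v (𝒢.brHomProfinite b v h x) =
      g * ℋ.brHomProfinite (f.branchMap b) (f.vertexMap v) (f.abuts_branchMap b v h)
        (f.edgeOf_branchMap b ▸ φ.hEAt (𝒢.graph.edgeOf b) (f.edgeMap (𝒢.graph.edgeOf b)) rfl x) *
        g⁻¹
    rw [hc]
    exact hg x

/-- The base of the induced morphism is the base of the 1-morphism. [cite: MochizukiSemiAnbd2006, Rem. 2.4.2 p.26] -/
@[simp] theorem toProfinite_base : φ.toProfinite.base = f := rfl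

/-- The vertex homomorphisms of the induced morphism. [cite: MochizukiSemiAnbd2006, Rem. 2.4.2 p.26] -/
theorem toProfinite_hV (v : 𝒢.graph.Vertex) : φ.toProfinite.hV v = φ.hVOfPath v (φ.vertexPath v) :=
  rfl

/-- The edge homomorphisms of the induced morphism. [cite: MochizukiSemiAnbd2006, Rem. 2.4.2 p.26] -/
theorem toProfinite_hE (e : 𝒢.graph.Edge) :
    φ.toProfinite.hE e = φ.hEOfPath e (f.edgeMap e) rfl (φ.edgePath e (f.edgeMap e) rfl) :=
  rfl

/-! ### 2-isomorphic 1-morphisms induce conjugate homomorphisms -/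

/-- **2-isomorphic 1-morphisms induce vertex homomorphisms that differ by inner automorphisms**
(Rmk 2.4.2: "identifying isomorphic 1-morphisms" is harmless on fundamental groups up to conjugacy;
`pi1Map_of_iso`). [cite: MochizukiSemiAnbd2006, Rem. 2.4.2 p.26] -/
theorem exists_conj_hVProfinite_of_iso2 {φ φ' : HomOver 𝒢 ℋ f} (σ : HomOver.Iso2 φ φ')
    (v : 𝒢.graph.Vertex) :
    ∃ g : Aut (ℋ.fibV (f.vertexMap v)), ∀ x,
      φ'.hVProfinite v x = g * φ.hVProfinite v x * g⁻¹ := by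
  obtain ⟨g, hg⟩ := exists_conj_autMulEquivOfIso_pi1Map_of_iso (σ.isoV v) (𝒢.fibV v)
    (φ.vertexPath v) (φ'.vertexPath v)
  exact ⟨g, fun x => hg x⟩

/-- … and likewise for the edge homomorphisms. [cite: MochizukiSemiAnbd2006, Rem. 2.4.2 p.26] -/
theorem exists_conj_hEAt_of_iso2 {φ φ' : HomOver 𝒢 ℋ f} (σ : HomOver.Iso2 φ φ')
    (e : 𝒢.graph.Edge) :
    ∃ g : Aut (ℋ.fibE (f.edgeMap e)), ∀ x,
      φ'.hEAt e (f.edgeMap e) rfl x = g * φ.hEAt e (f.edgeMap e) rfl x * g⁻¹ := by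
  obtain ⟨g, hg⟩ := exists_conj_autMulEquivOfIso_pi1Map_of_iso (σ.isoE e (f.edgeMap e) rfl)
    (𝒢.fibE e) (φ.edgePath e (f.edgeMap e) rfl) (φ'.edgePath e (f.edgeMap e) rfl)
  exact ⟨g, fun x => hg x⟩

/-! ### Classes of morphisms agree -/

/-- The image of `π₁(φ_v)` read along a path is open iff the image of `π₁(φ_v^*)` at the canonical
basepoint is open (transport is a homeomorphism). [cite: MochizukiSemiAnbd2006, Def 2.2(ii) p.24] -/
theorem isOpen_range_hVOfPath_iff (v : 𝒢.graph.Vertex)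
    (γ : (φ.φV v).pullback ⋙ 𝒢.fibV v ≅ ℋ.fibV (f.vertexMap v)) :
    IsOpen (Set.range (φ.hVOfPath v γ)) ↔
      IsOpen (Set.range (pi1Map (φ.φV v).pullback (𝒢.fibV v))) := by
  have h : Set.range (φ.hVOfPath v γ) =
      Aut.autMulEquivOfIso γ '' Set.range (pi1Map (φ.φV v).pullback (𝒢.fibV v)) := by
    rw [← Set.range_comp]; rfl
  rw [h, Aut.isOpen_image_autMulEquivOfIso_iff]

/-- The same for edges. [cite: MochizukiSemiAnbd2006, Def 2.2(ii) p.24] -/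
theorem isOpen_range_hEOfPath_iff (e : 𝒢.graph.Edge) (e' : ℋ.graph.Edge) (h : f.edgeMap e = e')
    (γ : (φ.φE e e' h).pullback ⋙ 𝒢.fibE e ≅ ℋ.fibE e') :
    IsOpen (Set.range (φ.hEOfPath e e' h γ)) ↔
      IsOpen (Set.range (pi1Map (φ.φE e e' h).pullback (𝒢.fibE e))) := by
  have h' : Set.range (φ.hEOfPath e e' h γ) =
      Aut.autMulEquivOfIso γ '' Set.range (pi1Map (φ.φE e e' h).pullback (𝒢.fibE e)) := by
    rw [← Set.range_comp]; rfl
  rw [h', Aut.isOpen_image_autMulEquivOfIso_iff]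

/-- **Locally open agrees**: `φ` is locally open (Def. 2.2 (ii): open images on `π̂₁` at EVERY
basepoint, t1's `Hom.IsLocallyOpen`) iff the induced morphism of profinite presentations is locally
open in abc-iut-L3-t2's sense (open images at the canonical basepoints) — basepoint independence by
`isOpen_range_pi1Map_iff_of_iso`. [cite: MochizukiSemiAnbd2006, Def 2.2(ii) p.24] -/
theorem isLocallyOpen_toProfinite_iff :
    φ.toProfinite.IsLocallyOpen ↔ φ.toHom.IsLocallyOpen := by
  constructor
  · rintro ⟨hV, hE⟩
    refine ⟨fun v F _ => ?_, fun e F _ => ?_⟩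
    · obtain ⟨i⟩ := nonempty_iso_of_fiberFunctor (𝒢.fibV v) F
      have h1 := (φ.isOpen_range_hVOfPath_iff v (φ.vertexPath v)).mp (hV v)
      exact (isOpen_range_pi1Map_iff_of_iso (φ.φV v).pullback i).mpr h1
    · obtain ⟨i⟩ := nonempty_iso_of_fiberFunctor (𝒢.fibE e) F
      have h1 := (φ.isOpen_range_hEOfPath_iff e (f.edgeMap e) rfl
        (φ.edgePath e (f.edgeMap e) rfl)).mp (hE e)
      exact (isOpen_range_pi1Map_iff_of_iso (φ.φE e (f.edgeMap e) rfl).pullback i).mpr h1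
  · rintro ⟨hV, hE⟩
    exact ⟨fun v => (φ.isOpen_range_hVOfPath_iff v (φ.vertexPath v)).mpr (hV v (𝒢.fibV v)),
      fun e => (φ.isOpen_range_hEOfPath_iff e (f.edgeMap e) rfl
        (φ.edgePath e (f.edgeMap e) rfl)).mpr (hE e (𝒢.fibE e))⟩

end HomOver

/-- A 1-morphism `φ : 𝒢 → ℋ` induces a morphism of profinite presentations (via its components
over its base). [cite: MochizukiSemiAnbd2006, Rem. 2.4.2 p.26] -/
noncomputable def Hom.toProfinite (φ : Hom 𝒢 ℋ) : ProfiniteSemiGraph.Hom 𝒢.toProfinite ℋ.toProfinite :=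
  φ.over.toProfinite

/-- The base is preserved. [cite: MochizukiSemiAnbd2006, Rem. 2.4.2 p.26] -/
@[simp] theorem Hom.toProfinite_base (φ : Hom 𝒢 ℋ) : φ.toProfinite.base = φ.base := rfl

end SemiGraphOfAnabelioids

end Literature.AnabelianGeometry.SemiGraphs

end
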